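import Mathlib.Data.Finset.Basic
import Mathlib.Data.Finset.Union
import Mathlib.Order.Basic
import Mathlib.Data.Fin.Tuple.Basic
import Mathlib.Tactic.DeriveCountable
import HarnessLib

/-!
# Untyped first-order pre-syntax with de Bruijn levels

Support file for the proof of the enumerability theorem
(`FirstOrder.Language.Theory.IsComputablyAxiomatizable.isRE`,
`Literature/ModelTheory/ExponentialFields/DecidableTheory.lean`; Enderton, *A Mathematical
Introduction to Logic*, §2.5 Enumerability Theorem and Cor. 25F, §3.5 Thm. 35I).

All proof theory needed for that theorem (a Hilbert calculus, its soundness and its Henkin-style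
completeness, and the arithmetisation of its proof checker) is carried out on the *untyped
pre-syntax* defined here, and is connected to Mathlib's `FirstOrder.Language.BoundedFormula` only
through semantics (`Literature/ModelTheory/ProofTheory/PreSemantics.lean`) and through Mathlib's
concrete Gödel numbering. The point of the pre-syntax is that it is a pair of plain inductive
types over `ℕ`: function and relation symbols are natural numbers (intended: the codes
`Encodable.encode ⟨n, f⟩` of the symbols of an encodable language), *parameters* (`param c`, the
Henkin constants of the completeness proof) are natural numbers, and variables are natural numbers
read as **de Bruijn levels**, exactly as the `Fin n`-indexed bound variables of Mathlib's
`BoundedFormula α n`: in a formula sitting under `k` quantifiers, `var i` (`i < k`) refers to the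
`i`-th enclosing quantifier counted from the *outside*, and `all φ` at depth `k` binds level `k`.
With levels, instantiating the outermost quantifier (`inst`) and weakening a formula under a new
quantifier (`liftAt`) never change the level at which they operate when passing under binders,
which keeps every syntactic operation a plain structural recursion.

To keep every recursion *single* (not mutual, not nested) the type `PreTerm` contains, besides
genuine terms (`var`, `param`, `func f args`), the two list formers `nil`, `cons`: the argument of
`func f` is one `PreTerm` intended to be a `cons`-list of terms. Ill-sorted trees are harmless:
semantics gives them a fixed junk value, and well-sortedness relative to an arity table is the
inductive predicate `PreTerm.Wf` (sort `none` = term, sort `some n` = argument list of length `n`).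

## Main definitions

* `Literature.ModelTheory.ProofTheory.PreFOL.PreTerm`, `Literature.ModelTheory.ProofTheory.PreFOL.PreFormula` (constructors `falsum`, `equal`, `rel`, `imp`,
  `all`; `PreFormula.not φ = imp φ falsum`).
* `liftAt m` (insert an unused level `m`), `inst m s` (substitute the term `s` for level `m` and
  shift higher levels down), `close k σ` (substitute `σ i` for the levels `i < k` and shift the
  levels `≥ k` down by `k`), `params` (finite set of parameters), `closed` (no `var`),
  `Wf` (well-formedness with respect to arity tables `ℕ → Option ℕ`).

## Main statements (all elementary structural inductions) [folklore]

* `inst_liftAt` : `(t.liftAt m).inst m s = t`, and the same for formulas;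
* `inst_close` : `(close k σ φ).inst 0 s = close (k + 1) (snocAt k σ s) φ` when the `σ i`, `i < k`,
  are closed — the key identity behind the `∀` case of the truth lemma;
* closed terms are fixed by `liftAt`, `inst`, `close`; `Wf` at depth `0` implies closed;
  `close` preserves well-formedness.

## References

* H. B. Enderton, *A Mathematical Introduction to Logic*, Academic Press (1972), §2.1–2.4.
* N. G. de Bruijn, *Lambda calculus notation with nameless dummies*, Indag. Math. 34 (1972)
  (levels vs. indices).
-/

namespace Literature.ModelTheory.ProofTheory.PreFOL

/-! ### Pre-terms -/

/-- Untyped pre-terms over `ℕ`-coded symbols: variables are de Bruijn *levels*, `param c` is the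
`c`-th parameter (Henkin constant), `func f args` applies the function symbol with code `f` to the
argument list `args`, and `nil`/`cons` build argument lists inside the same inductive type (so that
all recursions on pre-terms are single structural recursions). [folklore] -/
inductive PreTerm : Type
  | var (i : ℕ) : PreTerm
  | param (c : ℕ) : PreTerm
  | func (f : ℕ) (args : PreTerm) : PreTerm
  | nil : PreTerm
  | cons (t rest : PreTerm) : PreTerm
  deriving DecidableEq, Countable, Inhabited

namespace PreTerm

/-- Insert an unused level `m`: levels `≥ m` are shifted up by one (Mathlib's `liftAt 1 m`). [folklore] -/
def liftAt (m : ℕ) : PreTerm → PreTerm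
  | var i => if i < m then var i else var (i + 1)
  | param c => param c
  | func f args => func f (args.liftAt m)
  | nil => nil
  | cons t rest => cons (t.liftAt m) (rest.liftAt m)

/-- Substitute the term `s` for level `m` and shift the levels `> m` down by one (used with `s`
closed: instantiation of the outermost quantifier is `inst 0`). [folklore] -/
def inst : PreTerm → ℕ → PreTerm → PreTerm
  | var i, m, s => if i < m then var i else if i = m then s else var (i - 1)
  | param c, _, _ => param c
  | func f args, m, s => func f (args.inst m s)
  | nil, _, _ => nil
  | cons t rest, m, s => cons (t.inst m s) (rest.inst m s)

/-- Close the levels below `k` by the terms `σ 0, …, σ (k-1)` and shift the levels `≥ k` down by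
`k` (turns a formula of depth `k` into a sentence when the `σ i` are closed). [folklore] -/
def close (k : ℕ) (σ : ℕ → PreTerm) : PreTerm → PreTerm
  | var i => if i < k then σ i else var (i - k)
  | param c => param c
  | func f args => func f (args.close k σ)
  | nil => nil
  | cons t rest => cons (t.close k σ) (rest.close k σ)

/-- The finite set of parameters (Henkin constants) occurring in a pre-term. [folklore] -/
def params : PreTerm → Finset ℕ
  | var _ => ∅
  | param c => {c}
  | func _ args => args.params
  | nil => ∅
  | cons t rest => t.params ∪ rest.params

/-- A pre-term is *closed* if no variable occurs in it. [folklore] -/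
def closed : PreTerm → Bool
  | var _ => false
  | param _ => true
  | func _ args => args.closed
  | nil => true
  | cons t rest => t.closed && rest.closed

/-- Well-formedness of a pre-term at depth `k` with respect to an arity table
`arF : ℕ → Option ℕ` (`arF f = some n` iff `f` is a function symbol code of arity `n`):
sort `none` means "a term all of whose variables are `< k`", sort `some n` means "a `cons`-list of
`n` such terms". [folklore] -/
inductive Wf (arF : ℕ → Option ℕ) (k : ℕ) : Option ℕ → PreTerm → Prop
  | var {i : ℕ} : i < k → Wf arF k none (var i)
  | param (c : ℕ) : Wf arF k none (param c)
  | func {f n : ℕ} {args : PreTerm} : arF f = some n → Wf arF k (some n) args →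
      Wf arF k none (func f args)
  | nil : Wf arF k (some 0) nil
  | cons {t rest : PreTerm} {n : ℕ} : Wf arF k none t → Wf arF k (some n) rest →
      Wf arF k (some (n + 1)) (cons t rest)

/-- Extend an assignment `σ` of terms to levels by the value `s` at level `k`. [folklore] -/
def snocAt (k : ℕ) (σ : ℕ → PreTerm) (s : PreTerm) : ℕ → PreTerm :=
  fun i => if i = k then s else σ i

/-- `snocAt` at the new level. [folklore] -/
@[simp] theorem snocAt_self (k : ℕ) (σ : ℕ → PreTerm) (s : PreTerm) : snocAt k σ s k = s := by
  simp [snocAt]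

/-- `snocAt` below the new level agrees with `σ`. [folklore] -/
theorem snocAt_of_lt {k i : ℕ} (σ : ℕ → PreTerm) (s : PreTerm) (h : i < k) :
    snocAt k σ s i = σ i := by
  simp [snocAt, Nat.ne_of_lt h]

/-- Lifting at `m` and then instantiating level `m` is the identity. [folklore] -/
@[simp] theorem inst_liftAt (m : ℕ) (s : PreTerm) : ∀ t : PreTerm, (t.liftAt m).inst m s = t
  | var i => by
      unfold liftAt
      split_ifs with h
      · simp [inst, h]
      · have h1 : ¬ i + 1 < m := by omega
        have h2 : i + 1 ≠ m := by omega
        simp [inst, h1, h2]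
  | param c => rfl
  | func f args => by rw [liftAt, inst, inst_liftAt m s args]
  | nil => rfl
  | cons t rest => by rw [liftAt, inst, inst_liftAt m s t, inst_liftAt m s rest]

/-- Closed pre-terms are fixed by `inst`. [folklore] -/
theorem inst_of_closed (m : ℕ) (s : PreTerm) : ∀ {t : PreTerm}, t.closed = true → t.inst m s = t
  | var _, h => by simp [closed] at h
  | param _, _ => rfl
  | func f args, h => by
      rw [inst, inst_of_closed m s (t := args) (by simpa [closed] using h)]
  | nil, _ => rfl
  | cons t rest, h => by
      simp only [closed, Bool.and_eq_true] at h
      rw [inst, inst_of_closed m s h.1, inst_of_closed m s h.2]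

/-- Closed pre-terms are fixed by `liftAt`. [folklore] -/
theorem liftAt_of_closed (m : ℕ) : ∀ {t : PreTerm}, t.closed = true → t.liftAt m = t
  | var _, h => by simp [closed] at h
  | param _, _ => rfl
  | func f args, h => by
      rw [liftAt, liftAt_of_closed m (t := args) (by simpa [closed] using h)]
  | nil, _ => rfl
  | cons t rest, h => by
      simp only [closed, Bool.and_eq_true] at h
      rw [liftAt, liftAt_of_closed m h.1, liftAt_of_closed m h.2]

/-- Closed pre-terms are fixed by `close`. [folklore] -/
theorem close_of_closed (k : ℕ) (σ : ℕ → PreTerm) :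
    ∀ {t : PreTerm}, t.closed = true → t.close k σ = t
  | var _, h => by simp [closed] at h
  | param _, _ => rfl
  | func f args, h => by
      rw [close, close_of_closed k σ (t := args) (by simpa [closed] using h)]
  | nil, _ => rfl
  | cons t rest, h => by
      simp only [closed, Bool.and_eq_true] at h
      rw [close, close_of_closed k σ h.1, close_of_closed k σ h.2]

/-- Closing at depth `0` is the identity. [folklore] -/
@[simp] theorem close_zero (σ : ℕ → PreTerm) : ∀ t : PreTerm, t.close 0 σ = t
  | var i => by simp [close]
  | param _ => rfl
  | func f args => by rw [close, close_zero σ args]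
  | nil => rfl
  | cons t rest => by rw [close, close_zero σ t, close_zero σ rest]

/-- The key identity for the `∀` case of the truth lemma: instantiating level `0` after closing
the levels `< k` by closed terms is closing the levels `< k + 1`. [folklore] -/
theorem inst_close (k : ℕ) (σ : ℕ → PreTerm) (s : PreTerm) (hσ : ∀ i < k, (σ i).closed = true) :
    ∀ t : PreTerm, (t.close k σ).inst 0 s = t.close (k + 1) (snocAt k σ s)
  | var i => by
      unfold close
      by_cases h : i < k
      · have h' : i < k + 1 := by omega
        rw [if_pos h, if_pos h', snocAt_of_lt σ s h, inst_of_closed 0 s (hσ i h)]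
      · rw [if_neg h]
        by_cases he : i = k
        · subst he
          simp [inst, snocAt]
        · have h1 : ¬ i < k + 1 := by omega
          have h2 : ¬ i - k < 0 := by omega
          have h3 : i - k ≠ 0 := by omega
          rw [if_neg h1, inst, if_neg h2, if_neg h3]
          congr 1
  | param _ => rfl
  | func f args => by rw [close, inst, close, inst_close k σ s hσ args]
  | nil => rfl
  | cons t rest => by rw [close, inst, close, inst_close k σ s hσ t, inst_close k σ s hσ rest]

/-- Parameters of an instance. [folklore] -/
theorem params_inst_subset (m : ℕ) (s : PreTerm) :
    ∀ t : PreTerm, (t.inst m s).params ⊆ t.params ∪ s.params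
  | var i => by
      unfold inst
      split_ifs <;> simp [params]
  | param c => by simp [inst, params]
  | func f args => by simpa [inst, params] using params_inst_subset m s args
  | nil => by simp [inst, params]
  | cons t rest => by
      simp only [inst, params]
      intro x hx
      simp only [Finset.mem_union] at hx ⊢
      rcases hx with hx | hx
      · have := params_inst_subset m s t hx
        simp only [Finset.mem_union] at this
        tauto
      · have := params_inst_subset m s rest hx
        simp only [Finset.mem_union] at this
        tauto

/-- Parameters are unchanged by lifting. [folklore] -/
@[simp] theorem params_liftAt (m : ℕ) : ∀ t : PreTerm, (t.liftAt m).params = t.params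
  | var i => by
      unfold liftAt
      split_ifs <;> simp [params]
  | param c => rfl
  | func f args => by simp [liftAt, params, params_liftAt m args]
  | nil => rfl
  | cons t rest => by simp [liftAt, params, params_liftAt m t, params_liftAt m rest]

/-- Parameters of a closing. [folklore] -/
theorem mem_params_close {k : ℕ} {σ : ℕ → PreTerm} {c : ℕ} :
    ∀ {t : PreTerm}, c ∈ (t.close k σ).params → c ∈ t.params ∨ ∃ i < k, c ∈ (σ i).params
  | var i, h => by
      unfold close at h
      split_ifs at h with hi
      · exact Or.inr ⟨i, hi, h⟩
      · simp [params] at h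
  | param c', h => Or.inl h
  | func f args, h => by
      simpa [close, params] using mem_params_close (t := args) (by simpa [close, params] using h)
  | nil, h => by simp [close, params] at h
  | cons t rest, h => by
      simp only [close, params, Finset.mem_union] at h ⊢
      rcases h with h | h
      · rcases mem_params_close h with h' | h'
        · exact Or.inl (Or.inl h')
        · exact Or.inr h'
      · rcases mem_params_close h with h' | h'
        · exact Or.inl (Or.inr h')
        · exact Or.inr h'

/-- A well-formed pre-term at depth `0` is closed. [folklore] -/
theorem Wf.closed_of_zero {arF : ℕ → Option ℕ} {o : Option ℕ} {t : PreTerm}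
    (h : Wf arF 0 o t) : t.closed = true := by
  induction h with
  | var hi => exact absurd hi (Nat.not_lt_zero _)
  | param c => rfl
  | func _ _ ih => simpa [closed] using ih
  | nil => rfl
  | cons _ _ iht ihr => simp [closed, iht, ihr]

/-- Well-formedness is monotone in the depth. [folklore] -/
theorem Wf.mono {arF : ℕ → Option ℕ} {k k' : ℕ} (hk : k ≤ k') {o : Option ℕ} {t : PreTerm}
    (h : Wf arF k o t) : Wf arF k' o t := by
  induction h with
  | var hi => exact Wf.var (lt_of_lt_of_le hi hk)
  | param c => exact Wf.param c
  | func hf _ ih => exact Wf.func hf ih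
  | nil => exact Wf.nil
  | cons _ _ iht ihr => exact Wf.cons iht ihr

/-- Closing the levels `< k` of a depth-`(k + j)` well-formed pre-term by closed well-formed terms
gives a depth-`j` well-formed pre-term. [folklore] -/
theorem Wf.close {arF : ℕ → Option ℕ} {k j : ℕ} {σ : ℕ → PreTerm}
    (hσ : ∀ i < k, Wf arF 0 none (σ i)) {o : Option ℕ} {t : PreTerm} (h : Wf arF (k + j) o t) :
    Wf arF j o (t.close k σ) := by
  generalize hd : k + j = d at h
  induction h with
  | @var i hi =>
      unfold PreTerm.close
      by_cases h1 : i < k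
      · rw [if_pos h1]; exact (hσ _ h1).mono (Nat.zero_le _)
      · rw [if_neg h1]; exact Wf.var (by omega)
  | param c => exact Wf.param c
  | func hf _ ih => exact Wf.func hf ih
  | nil => exact Wf.nil
  | cons _ _ iht ihr => exact Wf.cons iht ihr

/-- Instantiating level `k` of a depth-`(k+1)` well-formed pre-term by a closed well-formed term
gives a depth-`k` well-formed pre-term. [folklore] -/
theorem Wf.inst {arF : ℕ → Option ℕ} {k : ℕ} {s : PreTerm} (hs : Wf arF 0 none s)
    {o : Option ℕ} {t : PreTerm} (h : Wf arF (k + 1) o t) : Wf arF k o (t.inst k s) := by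
  induction h with
  | @var i hi =>
      unfold PreTerm.inst
      by_cases h1 : i < k
      · rw [if_pos h1]; exact Wf.var h1
      · rw [if_neg h1]
        have : i = k := by omega
        rw [if_pos this]
        exact hs.mono (Nat.zero_le _)
  | param c => exact Wf.param c
  | func hf _ ih => exact Wf.func hf ih
  | nil => exact Wf.nil
  | cons _ _ iht ihr => exact Wf.cons iht ihr

/-- The sort of a well-formed pre-term is determined. [folklore] -/
theorem Wf.sort_unique {arF : ℕ → Option ℕ} {k : ℕ} {o o' : Option ℕ} {t : PreTerm}
    (h : Wf arF k o t) (h' : Wf arF k o' t) : o = o' := by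
  induction h generalizing o' with
  | var _ => cases h'; rfl
  | param _ => cases h'; rfl
  | func _ _ _ => cases h'; rfl
  | nil => cases h'; rfl
  | cons _ _ _ ihr => cases h' with | cons _ hr' => cases ihr hr'; rfl

/-- Build the `cons`-list of a finite family of pre-terms. [folklore] -/
def ofFn : {n : ℕ} → (Fin n → PreTerm) → PreTerm
  | 0, _ => nil
  | _ + 1, g => cons (g 0) (ofFn fun i => g i.succ)

/-- `ofFn` of the empty family. [folklore] -/
@[simp] theorem ofFn_zero (g : Fin 0 → PreTerm) : ofFn g = nil := rfl

/-- `ofFn` of a nonempty family. [folklore] -/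
@[simp] theorem ofFn_succ {n : ℕ} (g : Fin (n + 1) → PreTerm) :
    ofFn g = cons (g 0) (ofFn fun i => g i.succ) := rfl

/-- `ofFn` of well-formed terms is a well-formed argument list. [folklore] -/
theorem Wf.ofFn {arF : ℕ → Option ℕ} {k : ℕ} :
    ∀ {n : ℕ} {g : Fin n → PreTerm}, (∀ i, Wf arF k none (g i)) → Wf arF k (some n) (ofFn g)
  | 0, _, _ => Wf.nil
  | _ + 1, _, h => Wf.cons (h 0) (Wf.ofFn fun i => h i.succ)

/-- `inst` distributes over `ofFn`. [folklore] -/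
theorem inst_ofFn (m : ℕ) (s : PreTerm) :
    ∀ {n : ℕ} (g : Fin n → PreTerm), (ofFn g).inst m s = ofFn fun i => (g i).inst m s
  | 0, _ => rfl
  | _ + 1, g => by rw [ofFn_succ, inst, inst_ofFn m s (fun i => g i.succ)]; rfl

/-- `close` distributes over `ofFn`. [folklore] -/
theorem close_ofFn (k : ℕ) (σ : ℕ → PreTerm) :
    ∀ {n : ℕ} (g : Fin n → PreTerm), (ofFn g).close k σ = ofFn fun i => (g i).close k σ
  | 0, _ => rfl
  | _ + 1, g => by rw [ofFn_succ, close, close_ofFn k σ (fun i => g i.succ)]; rfl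

/-- `ofFn` of closed pre-terms is closed. [folklore] -/
theorem closed_ofFn : ∀ {n : ℕ} (g : Fin n → PreTerm), (∀ i, (g i).closed = true) → (ofFn g).closed = true
  | 0, _, _ => rfl
  | _ + 1, g, h => by
      rw [ofFn_succ, closed, h 0, closed_ofFn (fun i => g i.succ) (fun i => h i.succ)]
      rfl

/-- A well-formed argument list of length `n` is `ofFn` of `n` well-formed terms. [folklore] -/
theorem Wf.exists_ofFn {arF : ℕ → Option ℕ} {k : ℕ} :
    ∀ {n : ℕ} {t : PreTerm}, Wf arF k (some n) t →
      ∃ g : Fin n → PreTerm, t = PreTerm.ofFn g ∧ ∀ i, Wf arF k none (g i)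
  | n, PreTerm.var _, h => by cases h
  | n, PreTerm.param _, h => by cases h
  | n, PreTerm.func _ _, h => by cases h
  | n, PreTerm.nil, h => by
      cases h
      exact ⟨Fin.elim0, rfl, fun i => i.elim0⟩
  | n, PreTerm.cons t rest, h => by
      cases h with
      | cons ht hr =>
        obtain ⟨g, rfl, hg⟩ := Wf.exists_ofFn hr
        exact ⟨Fin.cons t g, by simp [PreTerm.ofFn_succ, Fin.cons_zero, Fin.cons_succ], Fin.cases ht hg⟩

end PreTerm

/-! ### Pre-formulas -/

/-- Untyped pre-formulas: `falsum`, equations, atomic relations (`rel r args`, `args` an argument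
list), implication and universal quantification over the next de Bruijn level. [folklore] -/
inductive PreFormula : Type
  | falsum : PreFormula
  | equal (t₁ t₂ : PreTerm) : PreFormula
  | rel (r : ℕ) (args : PreTerm) : PreFormula
  | imp (φ ψ : PreFormula) : PreFormula
  | all (φ : PreFormula) : PreFormula
  deriving DecidableEq, Countable, Inhabited

namespace PreFormula

/-- Negation `¬ φ := φ → ⊥`. [folklore] -/
abbrev not (φ : PreFormula) : PreFormula := imp φ falsum

/-- Insert an unused level `m` (weakening under one more quantifier). [folklore] -/
def liftAt (m : ℕ) : PreFormula → PreFormula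
  | falsum => falsum
  | equal t₁ t₂ => equal (t₁.liftAt m) (t₂.liftAt m)
  | rel r args => rel r (args.liftAt m)
  | imp φ ψ => imp (φ.liftAt m) (ψ.liftAt m)
  | all φ => all (φ.liftAt m)

/-- Substitute the term `s` for level `m`, shifting higher levels down (`inst 0 s φ` is the
instance `φ[s]` of `all φ`). [folklore] -/
def inst : PreFormula → ℕ → PreTerm → PreFormula
  | falsum, _, _ => falsum
  | equal t₁ t₂, m, s => equal (t₁.inst m s) (t₂.inst m s)
  | rel r args, m, s => rel r (args.inst m s)
  | imp φ ψ, m, s => imp (φ.inst m s) (ψ.inst m s)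
  | all φ, m, s => all (φ.inst m s)

/-- Close the levels `< k` by `σ` (a depth-`k` formula becomes a sentence). [folklore] -/
def close (k : ℕ) (σ : ℕ → PreTerm) : PreFormula → PreFormula
  | falsum => falsum
  | equal t₁ t₂ => equal (t₁.close k σ) (t₂.close k σ)
  | rel r args => rel r (args.close k σ)
  | imp φ ψ => imp (φ.close k σ) (ψ.close k σ)
  | all φ => all (φ.close k σ)

/-- The finite set of parameters occurring in a pre-formula. [folklore] -/
def params : PreFormula → Finset ℕ
  | falsum => ∅
  | equal t₁ t₂ => t₁.params ∪ t₂.params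
  | rel _ args => args.params
  | imp φ ψ => φ.params ∪ ψ.params
  | all φ => φ.params

/-- Well-formedness at depth `k` with respect to arity tables for function and relation symbol
codes. [folklore] -/
inductive Wf (arF arR : ℕ → Option ℕ) : ℕ → PreFormula → Prop
  | falsum {k : ℕ} : Wf arF arR k falsum
  | equal {k : ℕ} {t₁ t₂ : PreTerm} : t₁.Wf arF k none → t₂.Wf arF k none →
      Wf arF arR k (equal t₁ t₂)
  | rel {k r n : ℕ} {args : PreTerm} : arR r = some n → args.Wf arF k (some n) →
      Wf arF arR k (rel r args)
  | imp {k : ℕ} {φ ψ : PreFormula} : Wf arF arR k φ → Wf arF arR k ψ → Wf arF arR k (imp φ ψ)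
  | all {k : ℕ} {φ : PreFormula} : Wf arF arR (k + 1) φ → Wf arF arR k (all φ)

/-- Lifting at `m` and then instantiating level `m` is the identity. [folklore] -/
@[simp] theorem inst_liftAt (m : ℕ) (s : PreTerm) : ∀ φ : PreFormula, (φ.liftAt m).inst m s = φ
  | falsum => rfl
  | equal t₁ t₂ => by simp [liftAt, inst]
  | rel r args => by simp [liftAt, inst]
  | imp φ ψ => by rw [liftAt, inst, inst_liftAt m s φ, inst_liftAt m s ψ]
  | all φ => by rw [liftAt, inst, inst_liftAt m s φ]

/-- Closing at depth `0` is the identity. [folklore] -/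
@[simp] theorem close_zero (σ : ℕ → PreTerm) : ∀ φ : PreFormula, φ.close 0 σ = φ
  | falsum => rfl
  | equal t₁ t₂ => by simp [close]
  | rel r args => by simp [close]
  | imp φ ψ => by rw [close, close_zero σ φ, close_zero σ ψ]
  | all φ => by rw [close, close_zero σ φ]

/-- `inst 0 s ∘ close k σ = close (k+1) (snocAt k σ s)` on formulas, for closed `σ i` (`i < k`).
[folklore] -/
theorem inst_close (k : ℕ) (σ : ℕ → PreTerm) (s : PreTerm) (hσ : ∀ i < k, (σ i).closed = true) :
    ∀ φ : PreFormula, (φ.close k σ).inst 0 s = φ.close (k + 1) (PreTerm.snocAt k σ s)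
  | falsum => rfl
  | equal t₁ t₂ => by simp [close, inst, PreTerm.inst_close k σ s hσ]
  | rel r args => by simp [close, inst, PreTerm.inst_close k σ s hσ]
  | imp φ ψ => by rw [close, inst, close, inst_close k σ s hσ φ, inst_close k σ s hσ ψ]
  | all φ => by rw [close, inst, close, inst_close k σ s hσ φ]

/-- Parameters of an instance. [folklore] -/
theorem params_inst_subset (m : ℕ) (s : PreTerm) :
    ∀ φ : PreFormula, (φ.inst m s).params ⊆ φ.params ∪ s.params
  | falsum => by simp [inst, params]
  | equal t₁ t₂ => by
      simp only [inst, params]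
      intro x hx
      simp only [Finset.mem_union] at hx ⊢
      rcases hx with hx | hx
      · have := PreTerm.params_inst_subset m s t₁ hx
        simp only [Finset.mem_union] at this; tauto
      · have := PreTerm.params_inst_subset m s t₂ hx
        simp only [Finset.mem_union] at this; tauto
  | rel r args => by simpa [inst, params] using PreTerm.params_inst_subset m s args
  | imp φ ψ => by
      simp only [inst, params]
      intro x hx
      simp only [Finset.mem_union] at hx ⊢
      rcases hx with hx | hx
      · have := params_inst_subset m s φ hx
        simp only [Finset.mem_union] at this; tauto
      · have := params_inst_subset m s ψ hx
        simp only [Finset.mem_union] at this; tauto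
  | all φ => by simpa [inst, params] using params_inst_subset m s φ

/-- Parameters are unchanged by lifting. [folklore] -/
@[simp] theorem params_liftAt (m : ℕ) : ∀ φ : PreFormula, (φ.liftAt m).params = φ.params
  | falsum => rfl
  | equal t₁ t₂ => by simp [liftAt, params]
  | rel r args => by simp [liftAt, params]
  | imp φ ψ => by simp [liftAt, params, params_liftAt m φ, params_liftAt m ψ]
  | all φ => by simp [liftAt, params, params_liftAt m φ]

/-- Parameters of a closing. [folklore] -/
theorem mem_params_close {k : ℕ} {σ : ℕ → PreTerm} {c : ℕ} :
    ∀ {φ : PreFormula}, c ∈ (φ.close k σ).params → c ∈ φ.params ∨ ∃ i < k, c ∈ (σ i).params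
  | falsum, h => by simp [close, params] at h
  | equal t₁ t₂, h => by
      simp only [close, params, Finset.mem_union] at h ⊢
      rcases h with h | h
      · rcases PreTerm.mem_params_close h with h' | h'
        · exact Or.inl (Or.inl h')
        · exact Or.inr h'
      · rcases PreTerm.mem_params_close h with h' | h'
        · exact Or.inl (Or.inr h')
        · exact Or.inr h'
  | rel r args, h => by
      simpa [close, params] using PreTerm.mem_params_close (t := args) (by simpa [close, params] using h)
  | imp φ ψ, h => by
      simp only [close, params, Finset.mem_union] at h ⊢
      rcases h with h | h
      · rcases mem_params_close h with h' | h'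
        · exact Or.inl (Or.inl h')
        · exact Or.inr h'
      · rcases mem_params_close h with h' | h'
        · exact Or.inl (Or.inr h')
        · exact Or.inr h'
  | all φ, h => by
      simpa [close, params] using mem_params_close (φ := φ) (by simpa [close, params] using h)

/-- Closing the levels `< k` of a depth-`(k + j)` well-formed formula by closed well-formed terms
gives a depth-`j` well-formed formula (a sentence for `j = 0`). [folklore] -/
theorem Wf.close {arF arR : ℕ → Option ℕ} {k : ℕ} {σ : ℕ → PreTerm}
    (hσ : ∀ i < k, PreTerm.Wf arF 0 none (σ i)) :
    ∀ {j : ℕ} {φ : PreFormula}, Wf arF arR (k + j) φ → Wf arF arR j (φ.close k σ)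
  | j, PreFormula.falsum, _ => Wf.falsum
  | j, PreFormula.equal t₁ t₂, h => by
      cases h with
      | equal h₁ h₂ => exact Wf.equal (h₁.close hσ) (h₂.close hσ)
  | j, PreFormula.rel r args, h => by
      cases h with
      | rel hr ha => exact Wf.rel hr (ha.close hσ)
  | j, PreFormula.imp φ ψ, h => by
      cases h with
      | imp h₁ h₂ => exact Wf.imp (Wf.close hσ h₁) (Wf.close hσ h₂)
  | j, PreFormula.all φ, h => by
      cases h with
      | all h₁ => exact Wf.all (Wf.close hσ (j := j + 1) h₁)

end PreFormula

end Literature.ModelTheory.ProofTheory.PreFOL
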